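import Summits.QuantumAdvantage.QuantumAdvantage.Theorems.CubicForrelationNearExactIsExactAmmCeilingX
import Summits.QuantumAdvantage.QuantumAdvantage.Theorems.CubicForrelationNearExactIsExactRothausB
import Summits.QuantumAdvantage.QuantumAdvantage.Theorems.CubicForrelationNearExactIsExactMmWalsh
import Summits.QuantumAdvantage.QuantumAdvantage.Theorems.NearExactIsExact.Negative.BqqSeven

/-!
# `NearExactIsExact` (stmt-QuantumAdvantage-14043) — the Maiorana–McFarland DICHOTOMY `Φ ≤ 15/16 ∨ BQQ residual`,
  and the one-sided MM gap at `n = 14` against every cubic partner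

Setting of the landed ceiling `stub_mmFormCeiling` (`…MmFormCeiling`): `f` ANY cubic function on `m + m` bits, `g` in
Maiorana–McFarland SIGN FORM `(-1)^{g(y₁‖y₂)} = (-1)^{y₁·π(y₂)}(-1)^{h(y₂)}` with `π` coordinatewise quadratic (not
assumed bijective) and `h` arbitrary. The ceiling's fibre trichotomy ends, in its third case, with "`Φ` is the bias of
a word of degree `≤ 6`", whence `Φ ≤ 31/32`. This file sharpens the third case into the BQQ residual form and makes it
unconditional (stubs D, R, F1 are the landed `stub_derivDegree`, `bb_rmWeight_holds`, `stub_mmWalsh`):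

* `mmForm_dichotomy`: EITHER `Φ(f,g) ≤ 15/16`, OR there is a coordinatewise QUADRATIC `τ` with `τ ∘ π = id` (so `π`
  is a biquadratic bijection — `τ_i(a) = f(a‖0) ⊕ f(a‖e_i)`, a derivative of the cubic `f`) and
  `Φ(f,g) = 2^{-m} Σ_y (-1)^{h(y) ⊕ k(π y)}` with `k = f(·‖0)` cubic. (In the third case every fibre `f(π y‖·)` is
  affine with linear part `y`, which is exactly `τ(π y) = y`.)
* `mmForm_rigidity`: hence if `Φ(f,g) > 15/16` then `π` is a biquadratic PERMUTATION (inverse `τ`), `f` is itself in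
  MM sign form over `τ` with dual word `f(·‖0)` — `(-1)^{f(a‖x)} = (-1)^{x·τ(a)}(-1)^{f(a‖0)}` — and `Φ(f,g)` is the
  BQQ residual bias: near-exact pairs of this habitat are exactly the bijective biquadratic MM pairs of
  `Negative/BqqSeven`, `BqqEightNineTen`, `BqqNineTen`. (`mmForm_fibres` is the common core: `Φ ≤ 15/16` or all
  first differences of the fibres are `f(πy‖x) ⊕ f(πy‖x ⊕ eᵢ) = yᵢ`.)
* `mmForm_gap_of_bqq`: consequently the window statement BQQ(m) — "for biquadratic `τ ∘ π = id` and cubic `c₁, c₂`,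
  `c₁ ⊕ c₂∘π` is `0` or has weight `≥ 2^{m-5}`" — implies `Φ = 1 ∨ Φ ≤ 15/16` for EVERY cubic `f` against every such `g`
  on `2m` bits (the residual weight `w` gives `Φ = 1 − 2w/2^m`).
* `mmForm_gap_fourteen`: with `BqqSeven.bqq_seven` (`m = 7`), every cubic `f` and every `g` in biquadratic MM sign form
  on `14` bits have `Φ = 1 ∨ Φ ≤ 15/16`. (The instances `m = 8, 9, 10` follow verbatim from `BqqEightNineTen.bqq_eight`,
  `BqqNineTen.bqq_nine`, `BqqNineTen.bqq_ten` once those files are in the tree: DISPROOF §10.4's PROPOSITION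
  "no MM-shaped cubic pair on `n = 2s ≤ 20` bits has `Φ ∈ (15/16, 1)`".)

HONEST FRAMING: a structural THEOREM about one habitat (one-sided Maiorana–McFarland sign form over a quadratic map)
plus its finite instance `n = 14` — NOT summit progress: no violation of `NearExactIsExact`, no new per-`n` value
(at `n = 14` the tree's `θ₁₄ ≤ 61/64` is stronger for general pairs), nothing asymptotic beyond "beating `15/16` with such a `g` needs BQQ(m) to fail".
Orientation: C. Carlet, Boolean Functions for Cryptography and Coding Theory (CUP 2021), §2.2, §6.1; everything used
is proved in the tree; standard axioms.
-/

set_option linter.dupNamespace false -- D-0017: single-problem summit ⇒ `QuantumAdvantage.QuantumAdvantage` by design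

noncomputable section

namespace Summit.QuantumAdvantage.QuantumAdvantage.Theorems.NearExactIsExact.Negative.MmFormDichotomy

open Finset
open Literature.Computability.QuantumComplexity
open Literature.Computability.QuantumComplexity.BuzetChailloux (bxor zeroVec bxor_zeroVec)
open Summit.QuantumAdvantage.QuantumAdvantage.Theorems.CubicForrelation.NearExactIsExact
  (fc_bool_xor_eq_false fc_bool_xor_eq_true fc_bool_odd4 fc_bool_id1 fc_bool_id2 fc_deg_bxor fc_const_of_shift
    fc_sum_signOf_eq_zero_of_flip fc_sum_signOf_eq_card fc_abs_sum_signOf_le fc_bias fc_isDegLeFun_comp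
    fc_bxor_append fc_deg_coord_append_left fc_deg_coord_append_pi fc_linForm_exists fc_lin_props
    bb_rmWeight_holds stub_derivDegree stub_mmWalsh acx_deg_coord_append_right)
open Summit.QuantumAdvantage.QuantumAdvantage.Theorems.NearExactIsExact.Negative.BqqSeven (bqq_seven)

variable {m : ℕ}

/-! ### Tools -/

/-- Averaging: if `|S y| ≤ 2^m` everywhere and `|S y| ≤ b` on a set `s` with `16·#s·(2^m − b) ≥ 4^m`, then
`Σ_y |S y| ≤ (15/16)·4^m`. [folklore] -/
theorem avg_core (S : (Fin m → Bool) → ℝ) (hS : ∀ y, |S y| ≤ (2 : ℝ) ^ m) (s : Finset (Fin m → Bool))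
    (b : ℝ) (hb : ∀ y ∈ s, |S y| ≤ b) (hdef : (2 : ℝ) ^ m * 2 ^ m ≤ 16 * ((s.card : ℝ) * (2 ^ m - b))) :
    ∑ y, |S y| ≤ 15 / 16 * ((2 : ℝ) ^ m * 2 ^ m) := by
  classical
  rw [← sum_add_sum_compl s fun y => |S y|]
  have hin : ∑ y ∈ s, |S y| ≤ s.card * b := by
    rw [← nsmul_eq_mul]; exact sum_le_card_nsmul _ _ _ hb
  have hout : ∑ y ∈ sᶜ, |S y| ≤ (sᶜ).card * (2 : ℝ) ^ m := by
    rw [← nsmul_eq_mul]; exact sum_le_card_nsmul _ _ _ fun y _ => hS y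
  have hcard : ((s.card : ℝ) + ((sᶜ).card : ℝ)) * 2 ^ m = 2 ^ m * 2 ^ m := by
    rw [← Nat.cast_add, s.card_add_card_compl, Fintype.card_fun, Fintype.card_bool, Fintype.card_fin]
    push_cast
    rfl
  linarith [add_mul (s.card : ℝ) ((sᶜ).card : ℝ) ((2 : ℝ) ^ m)]

/-! ### The dichotomy -/

/-- **Core of the dichotomy (fibre trichotomy).** `f` cubic on `m + m` bits, `π` coordinatewise quadratic, `g` in MM
sign form over `π` with dual word `h` (arbitrary). Then either `Φ(f,g) ≤ 15/16`, or EVERY fibre `f(π y ‖ ·)` is affine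
with linear part `y`: all first differences are `f(πy‖x) ⊕ f(πy‖x ⊕ eᵢ) = yᵢ`, in sign form
`(-1)^{f(πy‖x)} = (-1)^{x·y}(-1)^{f(πy‖0)}`, and `Φ(f,g) = 2^{-m} Σ_y (-1)^{h(y) ⊕ f(π y ‖ 0)}`. Proof: the fibre
trichotomy of `stub_mmFormCeiling` (a non-affine fibre ⇒ `≥ 1/4` of the fibres non-affine ⇒ `Φ ≤ 15/16`; all affine,
one with linear part `≠ y` ⇒ `≥ 1/16` balanced ⇒ `Φ ≤ 15/16`; else the stated form). [this work] -/
theorem mmForm_fibres (f g : (Fin (m + m) → Bool) → Bool) (π : (Fin m → Bool) → (Fin m → Bool))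
    (h : (Fin m → Bool) → Bool) (hf : IsDegLeFun 3 f) (hπ : ∀ i : Fin m, IsDegLeFun 2 (fun y => π y i))
    (hg : ∀ y₁ y₂ : Fin m → Bool, signOf (g (Fin.append y₁ y₂)) = twist y₁ (π y₂) * signOf (h y₂)) :
    forrelation f g ≤ 15 / 16 ∨
      ((∀ y (i : Fin m) x, (f (Fin.append (π y) x) ^^ f (Fin.append (π y) (bxor x (Pi.single i true)))) = y i) ∧
        (∀ y x, signOf (f (Fin.append (π y) x)) = twist x y * signOf (f (Fin.append (π y) zeroVec))) ∧
        forrelation f g = ((2 : ℝ) ^ m)⁻¹ * ∑ y : Fin m → Bool, signOf (h y ^^ f (Fin.append (π y) zeroVec))) := by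
  classical
  have hD := stub_derivDegree
  have hR := bb_rmWeight_holds
  obtain ⟨l, hl1, hl⟩ := fc_linForm_exists m
  -- coordinate directions of the second block, the two derivatives of `f`, the fibre functions `q y = f(π y ‖ ·) ⊕ ℓ_y`
  obtain ⟨T, hT⟩ : ∃ T : Fin m → Fin (m + m) → Bool, ∀ i, T i = Fin.append zeroVec (Pi.single i true) :=
    ⟨_, fun _ => rfl⟩
  obtain ⟨D1, hD1⟩ : ∃ D1 : Fin m → (Fin (m + m) → Bool) → Bool, ∀ i z, D1 i z = (f z ^^ f (bxor z (T i))) :=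
    ⟨fun i z => f z ^^ f (bxor z (T i)), fun _ _ => rfl⟩
  obtain ⟨D2, hD2⟩ : ∃ D2 : Fin m → Fin m → (Fin (m + m) → Bool) → Bool,
      ∀ i j z, D2 i j z = (D1 i z ^^ D1 i (bxor z (T j))) := ⟨fun i j z => D1 i z ^^ D1 i (bxor z (T j)), fun _ _ _ => rfl⟩
  obtain ⟨q, hq⟩ : ∃ q : (Fin m → Bool) → (Fin m → Bool) → Bool,
      ∀ y x, q y x = (f (Fin.append (π y) x) ^^ l y x) := ⟨_, fun _ _ => rfl⟩
  have hD1deg : ∀ i, IsDegLeFun 2 (D1 i) := fun i => by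
    rw [show D1 i = fun z => (f z ^^ f (bxor z (T i))) from funext (hD1 i)]; exact hD (m + m) 2 f (T i) hf
  have hD2deg : ∀ i j, IsDegLeFun 1 (D2 i j) := fun i j => by
    rw [show D2 i j = fun z => (D1 i z ^^ D1 i (bxor z (T j))) from funext (hD2 i j)]
    exact hD (m + m) 1 (D1 i) (T j) (hD1deg i)
  have hqdeg : ∀ y, IsDegLeFun 3 (q y) := fun y => by
    rw [show q y = fun x => (f (Fin.append (π y) x) ^^ l y x) from funext (hq y)]
    exact fc_deg_bxor (fc_isDegLeFun_comp hf (fun x => Fin.append (π y) x) (fc_deg_coord_append_left (π y))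
      (by norm_num)) ((hl1 y).mono (by norm_num))
  have hshift : ∀ (c x : Fin m → Bool) (i : Fin m),
      bxor (Fin.append c x) (T i) = Fin.append c (bxor x (Pi.single i true)) := fun c x i => by
    rw [hT, fc_bxor_append, bxor_zeroVec]
  -- first and second coordinate derivatives of the fibre functions
  have hR1 : ∀ y i x, (q y x ^^ q y (bxor x (Pi.single i true))) = (D1 i (Fin.append (π y) x) ^^ y i) := by
    intro y i x
    rw [hq, hq, hD1, hshift, (fc_lin_props (hl y)).1, (fc_lin_props (hl y)).2.1]
    exact fc_bool_id1 _ _ _ _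
  have hR2 : ∀ y i j x, ((D1 i (Fin.append (π y) x) ^^ y i) ^^ (D1 i (Fin.append (π y) (bxor x (Pi.single j true))) ^^ y i))
      = D2 i j (Fin.append (π y) x) := fun y i j x => by
    rw [hD2, hshift]
    exact fc_bool_id2 _ _ _
  -- the three kinds of fibres
  have fibA : ∀ y i j x₀, D2 i j (Fin.append (π y) x₀) = true → |∑ x, signOf (q y x)| ≤ 3 / 4 * (2 : ℝ) ^ m := by
    intro y i j x₀ hx₀
    have e : ((q y x₀ ^^ q y (bxor x₀ (Pi.single i true))) ^^ (q y (bxor x₀ (Pi.single j true)) ^^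
        q y (bxor (bxor x₀ (Pi.single j true)) (Pi.single i true)))) = true := by rw [hR1, hR1, hR2, hx₀]
    obtain ⟨h1, h0⟩ := fc_bool_odd4 _ _ _ _ e
    exact fc_bias hR (hqdeg y) (by rcases h1 with h | h | h | h <;> exact ⟨_, h⟩)
      (by rcases h0 with h | h | h | h <;> exact ⟨_, h⟩)
  have fibC : ∀ y, (∀ i j x, D2 i j (Fin.append (π y) x) = false) →
      ∀ i x₀, (D1 i (Fin.append (π y) x₀) ^^ y i) = true → ∑ x, signOf (q y x) = 0 := by
    intro y hA i x₀ hx₀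
    have hc : ∀ x, (D1 i (Fin.append (π y) x) ^^ y i) = (D1 i (Fin.append (π y) zeroVec) ^^ y i) :=
      fc_const_of_shift (fun x => D1 i (Fin.append (π y) x) ^^ y i) fun j x =>
        fc_bool_xor_eq_false _ _ ((hR2 y i j x).trans (hA i j x))
    exact fc_sum_signOf_eq_zero_of_flip (q y) (Pi.single i true) fun x =>
      fc_bool_xor_eq_true _ _ ((hR1 y i x).trans ((hc x).trans ((hc x₀).symm.trans hx₀)))
  have fibK : ∀ y, (∀ i x, (D1 i (Fin.append (π y) x) ^^ y i) = false) →
      ∑ x, signOf (q y x) = (2 : ℝ) ^ m * signOf (f (Fin.append (π y) zeroVec)) := by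
    intro y hC
    have hc := fc_const_of_shift (q y) (fun i x => fc_bool_xor_eq_false _ _ ((hR1 y i x).trans (hC i x)))
    rw [show ∑ x, signOf (q y x) = ∑ _x : Fin m → Bool, signOf (q y zeroVec) from sum_congr rfl fun x _ => by rw [hc x],
      sum_const, card_univ, Fintype.card_fun, Fintype.card_bool, Fintype.card_fin, nsmul_eq_mul, hq,
      (fc_lin_props (hl y)).2.2, Bool.xor_false]
    push_cast
    rfl
  -- Φ through F1, and the common endgame
  have hΦ := stub_mmWalsh m f g π h hg
  simp_rw [show ∀ y, ∑ x, signOf (f (Fin.append (π y) x)) * twist x y = ∑ x, signOf (q y x) from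
    fun y => sum_congr rfl fun x _ => by rw [hq, signOf_xor, hl]] at hΦ
  rw [hΦ]
  have h2m : (2 : ℝ) ^ (2 * m) = 2 ^ m * 2 ^ m := by rw [two_mul, pow_add]
  have hMpos : (0 : ℝ) < 2 ^ m * 2 ^ m := by positivity
  have fin : ∑ y, |∑ x, signOf (q y x)| ≤ 15 / 16 * ((2 : ℝ) ^ m * 2 ^ m) →
      ((2 : ℝ) ^ (2 * m))⁻¹ * ∑ y, signOf (h y) * ∑ x, signOf (q y x) ≤ 15 / 16 := fun hb => by
    have h1 : ∑ y, signOf (h y) * ∑ x, signOf (q y x) ≤ ∑ y, |∑ x, signOf (q y x)| :=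
      sum_le_sum fun y _ => (le_abs_self _).trans (by rw [abs_mul, abs_signOf, one_mul])
    rw [h2m, inv_mul_le_iff₀ hMpos]
    linarith
  by_cases hA : ∃ y i j x, D2 i j (Fin.append (π y) x) = true
  · -- a non-affine fibre: ≥ 1/4 of the fibres are non-affine
    obtain ⟨y₀, i, j, x₀, h₀⟩ := hA
    have hv : IsDegLeFun 2 (fun y => D2 i j (Fin.append (π y) x₀)) :=
      fc_isDegLeFun_comp (hD2deg i j) (fun y => Fin.append (π y) x₀) (fc_deg_coord_append_pi hπ x₀) (by norm_num)
    have hRv := (Nat.cast_le (α := ℝ)).2 (hR m 2 _ hv ⟨y₀, h₀⟩)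
    push_cast at hRv
    exact Or.inl (fin (avg_core (fun y => ∑ x, signOf (q y x)) (fun y => fc_abs_sum_signOf_le (q y))
      (univ.filter fun y => D2 i j (Fin.append (π y) x₀) = true) (3 / 4 * 2 ^ m)
      (fun y hy => fibA y i j x₀ (mem_filter.1 hy).2) (by nlinarith [hRv, pow_pos (show (0 : ℝ) < 2 by norm_num) m])))
  by_cases hC : ∃ y i x, (D1 i (Fin.append (π y) x) ^^ y i) = true
  · -- all fibres affine, one non-constant: ≥ 1/16 of the fibres are balanced
    simp only [not_exists, Bool.not_eq_true] at hA
    obtain ⟨y₀, i, x₀, h₀⟩ := hC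
    have hv : IsDegLeFun 4 (fun y => D1 i (Fin.append (π y) x₀) ^^ y i) :=
      fc_deg_bxor (fc_isDegLeFun_comp (hD1deg i) (fun y => Fin.append (π y) x₀) (fc_deg_coord_append_pi hπ x₀)
        (by norm_num)) (isDegLeFun_apply i (by norm_num))
    have hRv := (Nat.cast_le (α := ℝ)).2 (hR m 4 _ hv ⟨y₀, h₀⟩)
    push_cast at hRv
    exact Or.inl (fin (avg_core (fun y => ∑ x, signOf (q y x)) (fun y => fc_abs_sum_signOf_le (q y))
      (univ.filter fun y => (D1 i (Fin.append (π y) x₀) ^^ y i) = true) 0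
      (fun y hy => (abs_eq_zero.2 (fibC y (hA y) i x₀ (mem_filter.1 hy).2)).le)
      (by nlinarith [hRv, pow_pos (show (0 : ℝ) < 2 by norm_num) m])))
  -- every fibre is affine with linear part `y`
  simp only [not_exists, Bool.not_eq_true] at hC
  have hsum : ∑ y, signOf (h y) * ∑ x, signOf (q y x) = 2 ^ m * ∑ y, signOf (h y ^^ f (Fin.append (π y) zeroVec)) := by
    rw [mul_sum]
    exact sum_congr rfl fun y _ => by rw [fibK y (hC y), signOf_xor]; ring
  have hsg : ∀ y x, signOf (f (Fin.append (π y) x)) = twist x y * signOf (f (Fin.append (π y) zeroVec)) := by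
    intro y x
    have hc := fc_const_of_shift (q y) (fun i x => fc_bool_xor_eq_false _ _ ((hR1 y i x).trans (hC y i x)))
    have e := congrArg signOf (hc x)
    rw [hq, hq, (fc_lin_props (hl y)).2.2, Bool.xor_false, signOf_xor, hl] at e
    have htt : twist x y * twist x y = 1 := by rw [← abs_mul_abs_self, abs_twist, one_mul]
    calc signOf (f (Fin.append (π y) x)) = twist x y * (signOf (f (Fin.append (π y) x)) * twist x y) := by
          rw [mul_comm (signOf _) (twist x y), ← mul_assoc, htt, one_mul]
      _ = _ := by rw [e]
  refine Or.inr ⟨fun y i x => ?_, hsg, ?_⟩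
  · have e := (fc_bool_xor_eq_false _ _ (hC y i x)).symm
    rwa [hD1, hshift] at e
  · rw [hsum, h2m, mul_inv, mul_assoc, inv_mul_cancel_left₀ (pow_ne_zero _ two_ne_zero)]

/-- **Maiorana–McFarland dichotomy.** `f` cubic on `m + m` bits, `π` coordinatewise quadratic, `g` in MM sign form
over `π` with dual word `h` (arbitrary). Then either `Φ(f,g) ≤ 15/16`, or `π` has a coordinatewise quadratic left
inverse `τ` (`τ (π y) = y`) and `Φ(f,g) = 2^{-m} Σ_y (-1)^{h(y) ⊕ f(π y ‖ 0)}` — the BQQ residual form with the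
cubics `c₁ = h`, `c₂ = f(·‖0)`. From `mmForm_fibres`: `τᵢ := f(·‖0) ⊕ f(·‖eᵢ)` (a derivative of a cubic, degree
`≤ 2` by `stub_derivDegree`) inverts `π`. [this work] -/
theorem mmForm_dichotomy (f g : (Fin (m + m) → Bool) → Bool) (π : (Fin m → Bool) → (Fin m → Bool))
    (h : (Fin m → Bool) → Bool) (hf : IsDegLeFun 3 f) (hπ : ∀ i : Fin m, IsDegLeFun 2 (fun y => π y i))
    (hg : ∀ y₁ y₂ : Fin m → Bool, signOf (g (Fin.append y₁ y₂)) = twist y₁ (π y₂) * signOf (h y₂)) :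
    forrelation f g ≤ 15 / 16 ∨
      ∃ τ : (Fin m → Bool) → (Fin m → Bool), (∀ i, IsDegLeFun 2 (fun x => τ x i)) ∧ (∀ y, τ (π y) = y) ∧
        forrelation f g = ((2 : ℝ) ^ m)⁻¹ * ∑ y : Fin m → Bool, signOf (h y ^^ f (Fin.append (π y) zeroVec)) := by
  classical
  rcases mmForm_fibres f g π h hf hπ hg with hle | ⟨hK, -, hΦ⟩
  · exact Or.inl hle
  refine Or.inr ⟨fun a i => f (Fin.append a zeroVec) ^^ f (Fin.append a (bxor zeroVec (Pi.single i true))),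
    fun i => ?_, fun y => funext fun i => hK y i zeroVec, hΦ⟩
  rw [show (fun a : Fin m → Bool => f (Fin.append a zeroVec) ^^ f (Fin.append a (bxor zeroVec (Pi.single i true))))
      = fun a => (fun z => f z ^^ f (bxor z (Fin.append zeroVec (Pi.single i true)))) (Fin.append a zeroVec) from
    funext fun a => by simp only [fc_bxor_append, bxor_zeroVec]]
  exact fc_isDegLeFun_comp (stub_derivDegree (m + m) 2 f _ hf) (fun a : Fin m → Bool => Fin.append a zeroVec)
    (acx_deg_coord_append_right zeroVec) (by norm_num)

/-- **Maiorana–McFarland rigidity of near-exact pairs.** If `f` is cubic, `g` is in MM sign form over a coordinatewise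
quadratic `π` (dual word `h` arbitrary) and `Φ(f,g) > 15/16`, then `π` is a PERMUTATION with coordinatewise quadratic
inverse `τ`, `f` is itself in MM sign form over `τ` with dual word `f(·‖0)` —
`(-1)^{f(a‖x)} = (-1)^{x·τ(a)}(-1)^{f(a‖0)}` — and `Φ(f,g) = 2^{-m} Σ_y (-1)^{h(y) ⊕ f(πy‖0)}`: the pair is a bijective
biquadratic MM pair and `Φ` its BQQ residual bias. [this work] -/
theorem mmForm_rigidity (f g : (Fin (m + m) → Bool) → Bool) (π : (Fin m → Bool) → (Fin m → Bool))
    (h : (Fin m → Bool) → Bool) (hf : IsDegLeFun 3 f) (hπ : ∀ i : Fin m, IsDegLeFun 2 (fun y => π y i))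
    (hg : ∀ y₁ y₂ : Fin m → Bool, signOf (g (Fin.append y₁ y₂)) = twist y₁ (π y₂) * signOf (h y₂))
    (hΦ : 15 / 16 < forrelation f g) :
    ∃ τ : (Fin m → Bool) → (Fin m → Bool), (∀ i, IsDegLeFun 2 (fun x => τ x i)) ∧ (∀ y, τ (π y) = y) ∧
      (∀ a, π (τ a) = a) ∧
      (∀ a x, signOf (f (Fin.append a x)) = twist x (τ a) * signOf (f (Fin.append a zeroVec))) ∧
      forrelation f g = ((2 : ℝ) ^ m)⁻¹ * ∑ y : Fin m → Bool, signOf (h y ^^ f (Fin.append (π y) zeroVec)) := by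
  classical
  rcases mmForm_fibres f g π h hf hπ hg with hle | ⟨-, hsg, hΦ'⟩
  · exact absurd hΦ (not_lt.2 hle)
  rcases mmForm_dichotomy f g π h hf hπ hg with hle | ⟨τ, hτ, hτπ, -⟩
  · exact absurd hΦ (not_lt.2 hle)
  have hinj : Function.Injective π := fun a b hab => by rw [← hτπ a, ← hτπ b, hab]
  have hsurj : Function.Surjective π := Finite.surjective_of_injective hinj
  refine ⟨τ, hτ, hτπ, fun a => ?_, fun a x => ?_, hΦ'⟩
  · obtain ⟨y, rfl⟩ := hsurj a
    rw [hτπ]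
  · obtain ⟨y, rfl⟩ := hsurj a
    rw [hτπ]
    exact hsg y x

/-! ### From BQQ(m) to the gap -/

/-- **BQQ(m) ⇒ one-sided MM gap on `2m` bits.** If every biquadratic `τ ∘ π = id` on `𝔽₂ᵐ` with cubics `c₁, c₂` has
residual `c₁ ⊕ c₂∘π` equal to `0` or of weight `w` with `32·w ≥ 2^m`, then every cubic `f` and every `g` in MM sign
form over a coordinatewise quadratic `π` with cubic dual word `h` satisfy `Φ(f,g) = 1 ∨ Φ(f,g) ≤ 15/16`.
[this work] -/
theorem mmForm_gap_of_bqq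
    (hB : ∀ (π τ : (Fin m → Bool) → (Fin m → Bool)), (∀ i, IsDegLeFun 2 (fun y => π y i)) →
      (∀ i, IsDegLeFun 2 (fun x => τ x i)) → (∀ y, τ (π y) = y) →
      ∀ c₁ c₂ : (Fin m → Bool) → Bool, IsDegLeFun 3 c₁ → IsDegLeFun 3 c₂ →
      (∀ y, c₁ y = c₂ (π y)) ∨ 2 ^ m ≤ 32 * #(univ.filter fun y => (c₁ y ^^ c₂ (π y)) = true))
    (f g : (Fin (m + m) → Bool) → Bool) (π : (Fin m → Bool) → (Fin m → Bool)) (h : (Fin m → Bool) → Bool)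
    (hf : IsDegLeFun 3 f) (hπ : ∀ i : Fin m, IsDegLeFun 2 (fun y => π y i)) (hh : IsDegLeFun 3 h)
    (hg : ∀ y₁ y₂ : Fin m → Bool, signOf (g (Fin.append y₁ y₂)) = twist y₁ (π y₂) * signOf (h y₂)) :
    forrelation f g = 1 ∨ forrelation f g ≤ 15 / 16 := by
  classical
  rcases mmForm_dichotomy f g π h hf hπ hg with hle | ⟨τ, hτ, hτπ, hΦ⟩
  · exact Or.inr hle
  have hk : IsDegLeFun 3 (fun a : Fin m → Bool => f (Fin.append a zeroVec)) :=
    fc_isDegLeFun_comp hf (fun a : Fin m → Bool => Fin.append a zeroVec) (acx_deg_coord_append_right zeroVec)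
      (by norm_num)
  have hpos : (0 : ℝ) < 2 ^ m := by positivity
  rw [hΦ]
  rcases hB π τ hπ hτ hτπ h (fun a => f (Fin.append a zeroVec)) hh hk with h0 | hw
  · left
    rw [show ∑ y, signOf (h y ^^ f (Fin.append (π y) zeroVec)) = ∑ _y : Fin m → Bool, (1 : ℝ) from
      sum_congr rfl fun y _ => by rw [h0 y, Bool.xor_self]; rfl, sum_const, card_univ, Fintype.card_fun,
      Fintype.card_bool, Fintype.card_fin, nsmul_eq_mul, mul_one]
    push_cast
    exact inv_mul_cancel₀ hpos.ne'
  · right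
    have hw' := (Nat.cast_le (α := ℝ)).2 hw
    push_cast at hw'
    rw [fc_sum_signOf_eq_card, inv_mul_le_iff₀ hpos]
    linarith

/-! ### `n = 14` -/

/-- **One-sided MM gap at `n = 14`.** Every cubic `f` and every `g` in Maiorana–McFarland sign form over a
coordinatewise quadratic `π : 𝔽₂⁷ → 𝔽₂⁷` with cubic dual word `h` have `Φ(f,g) = 1 ∨ Φ(f,g) ≤ 15/16`
(`mmForm_gap_of_bqq` with `BqqSeven.bqq_seven`: residual weight `0` or `≥ 8 = 2⁷/16`). [this work] -/
theorem mmForm_gap_fourteen (f g : (Fin (7 + 7) → Bool) → Bool) (π : (Fin 7 → Bool) → (Fin 7 → Bool))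
    (h : (Fin 7 → Bool) → Bool) (hf : IsDegLeFun 3 f) (hπ : ∀ i : Fin 7, IsDegLeFun 2 (fun y => π y i))
    (hh : IsDegLeFun 3 h)
    (hg : ∀ y₁ y₂ : Fin 7 → Bool, signOf (g (Fin.append y₁ y₂)) = twist y₁ (π y₂) * signOf (h y₂)) :
    forrelation f g = 1 ∨ forrelation f g ≤ 15 / 16 :=
  mmForm_gap_of_bqq (fun π τ hπ hτ hτπ c₁ c₂ h₁ h₂ =>
    (bqq_seven π τ hπ hτ hτπ c₁ c₂ h₁ h₂).imp_right fun h8 => by simp only [Nat.reducePow]; omega)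
    f g π h hf hπ hh hg

end Summit.QuantumAdvantage.QuantumAdvantage.Theorems.NearExactIsExact.Negative.MmFormDichotomy

end
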